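import Summits.QuantumFields.YangMills.Theorems.BalabanUVNodesN19LawPriceTwoSided
import Summits.QuantumFields.YangMills.Theorems.BalabanUVNodesN19LawIncrementsTarget

/-!
# YM-DAG node N19 (= NE7 proper) — THE LAW-SUMMABILITY THRESHOLD OF THE WINDOW CURRENCY, UPPER HALF:
# `MatchingModConstants vol l₀ δ` ⇒ per-step law increments `≤ C(l₀)(K+G)·r(log⁺(2vol·δ_K)⁻¹)`, so `Σ_K r(log⁺(vol·δ_K)⁻¹) < ∞` ⇒ summable

Cell `pub-ymgap`, HUMAN RULING D-0062 (Track A) ∕ D-0149 (work-bound push), R141 (C) wider-strategy seat `pub-ymgap-dag-n19-e` (strategy s3 =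
ALTERNATIVE CURRENCY), generation g22, module 1 (lineage module 74).  Route `Summits/QuantumFields/YangMills/Theses/BalabanUVNodes.lean` rev 25,
cluster item K3⁷ «SpineGivenEndpointR13SepCoPH» (stmt-QuantumFields-20544); filed `--supports` that item `--as helper` (it proves no registered
stub).  COUNT-NEUTRAL: [folklore] real analysis over Mathlib (`Real.posLog`, `Set.projIcc`) + the lineage BY NAME — p555512 `…N19LawPriceTwoSided`
(`law_price_le_logRate`, `abs_integral_le_of_Icc_symm`) and module 64 `…N19LawIncrementsTarget` (`law_prodObs_Icc_compl`, `genFun_schemeZ_eq_cgf_law`);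
N19's DECL-target SHAPE `Spine.NE7.Target` ∕ `MatchingModConstants` is a HYPOTHESIS here; no Theses import; NOT a discharge claim.

THE QUESTION (modules 64 ∕ 68 ∕ 73 left it as prose).  LAW-summable ⇒ `Target` (64, linear) ⇒ LAW-convergent (p556871), neither arrow reverses (68:
polynomial remainders; 73: super-geometric `l₀^m∕m!`).  WHICH remainders `δ` make N19's matching control the string laws' bounded-Lipschitz increments SUMMABLY?

THE ANSWER, UPPER HALF (this file; the lower half and the exact threshold for antitone remainders are the sibling module 75
`…N19LawSummabilityThresholdSharp`).  With p555512's two-sided per-step law price `r(L) = log(e+L)∕(1+L)` at `L = log⁺ε⁻¹`: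
* §1 the rate function: `0 < r ≤ 1` on `L ≥ 0`, ANTITONE in `L` (`logRate_antitone`: `log(e+b) ≤ log(e+a) + (b−a)∕(e+a)`), `r(L) ≤ (1+d)·r(L+d)`
  (`logRate_le_mul_logRate_add`), hence `ε ↦ r(log⁺ε⁻¹)` is MONOTONE and doubling `ε` costs at most the factor `1 + log 2`
  (`logRate_posLog_inv_mono`, `logRate_posLog_inv_le_of_le_mul`);
* §2 ★ `law_increment_le_logRate`: p555512's `|∫g dν − ∫g dμ| ≤ 384·c(l₀)·(K+G)·r(log⁺ε⁻¹)` for laws on `[−1,1]` with cgfs `ε`-close on `|t| ≤ l₀`,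
  now for EVERY real `ε` (for `ε = 0` or `ε > 1` it is the trivial bound `2G`, for `ε < 0` the hypothesis is empty) and (★ `…_of_lipschitzOn`) for
  tests Lipschitz ∕ bounded ON `[−1,1]` only (retraction `Set.projIcc`);
* §3 ★★ `lawIncrement_le_logRate_of_matchingModConstants`: probability laws `λ_K` on `[−1,1]` with `MatchingModConstants vol l₀ δ (K t ↦ mgf λ_K t)`
  have `|c_K| ≤ vol·δ_K` (read the matching at `t = 0`, where every cgf vanishes), so consecutive cgfs are `2vol·δ_K`-close on the window and every
  step's increment over `K_g`-Lipschitz `G_g`-bounded tests is `≤ 384c(l₀)(K_g+G_g)·r(log⁺(2vol·δ_K)⁻¹)`; ★★ `summable_lawIncrements_of_matchingModConstants`: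
  **`Σ_K r(log⁺(vol·δ_K)⁻¹) < ∞` ⇒ the increments are summable** along every uniformly Lipschitz-bounded test sequence (e.g. `δ_K = e^{−K²}`:
  `r ≍ log K∕K²`; NOT for geometric `δ`, where `r ≍ log K∕K` — module 75 shows that side is sharp);
* §4 the same AT THE SCHEME under `MatchingModConstants vol l₀ δ (schemeZ S os)` (a fortiori `Spine.NE7.Target`) for the laws of `∏os` under `gibbs_K`
  (★ `…_scheme`, ★ `summable_lawIncrements_of_target`).  (UNIFORM target, every string: module 62's moment road is sharper, `1∕(1+L)`; here one string.)

HONEST FRAMING (binding).  Elementary and [folklore]; TOY laws (`Z_K = mgf λ_K`) resp. the scheme under a HYPOTHESIS; NO consumer in the DAG today (a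
structural statement about the seat's own currencies); nothing of Bałaban's instantiated; NE7 NOT PRINTED, NOT proved; N19 NOT discharged; count-neutral.
One finite `T⁴` programme at fixed `ε`; nothing continuum ∕ `ℝ⁴` ∕ OS ∕ mass-gap ∕ Clay.  0 `def` ∕ 0 `sorry`.
-/

noncomputable section

open Real Filter Topology MeasureTheory ProbabilityTheory

namespace Summit.QuantumFields.YangMills.Theorems.BalabanUVNodesN19LawSummabilityThreshold

open Literature.MathematicalPhysics.QuantumFieldTheory.Balaban1983to89
open T4GenFunBounds (prodObs gibbsMeasure schemeZ)
open T4CauchySum (MatchingModConstants genFun)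
open Missing (TorusScheme)
open Summit.QuantumFields.BalabanUV.T4Continuum.Spine
open Summit.QuantumFields.YangMills.Theorems.BalabanUVNodesN19LawPriceTwoSided (law_price_le_logRate abs_integral_le_of_Icc_symm)
open Summit.QuantumFields.YangMills.Theorems.BalabanUVNodesN19LawIncrementsTarget (law_prodObs_Icc_compl genFun_schemeZ_eq_cgf_law)

/-! ## §1 The rate function `r(L) = log(e+L)∕(1+L)` [folklore] -/

/-- `1∕(1+L) ≤ r(L)` for `L ≥ 0` (`1 ≤ log(e+L)`). [folklore] -/
theorem one_div_le_logRate {L : ℝ} (hL : 0 ≤ L) : 1 / (1 + L) ≤ Real.log (Real.exp 1 + L) / (1 + L) := by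
  have h1 : (1 : ℝ) ≤ Real.log (Real.exp 1 + L) := by
    calc (1 : ℝ) = Real.log (Real.exp 1) := (Real.log_exp 1).symm
      _ ≤ Real.log (Real.exp 1 + L) := Real.log_le_log (Real.exp_pos 1) (by linarith)
  exact div_le_div_of_nonneg_right h1 (by linarith)

/-- `log(e+L) ≤ 1 + L` for `L ≥ 0` (`e + L ≤ e·e^L`). [folklore] -/
theorem log_exp_one_add_le {L : ℝ} (hL : 0 ≤ L) : Real.log (Real.exp 1 + L) ≤ 1 + L := by
  have h1 : 1 + L ≤ Real.exp L := by linarith [Real.add_one_le_exp L]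
  have he1 : 1 ≤ Real.exp 1 := by linarith [Real.add_one_le_exp (1 : ℝ)]
  have he : Real.exp 1 + L ≤ Real.exp (1 + L) := by
    rw [Real.exp_add]
    nlinarith [mul_le_mul_of_nonneg_left h1 (Real.exp_pos 1).le, Real.exp_pos L]
  calc Real.log (Real.exp 1 + L) ≤ Real.log (Real.exp (1 + L)) := Real.log_le_log (by positivity) he
    _ = 1 + L := Real.log_exp _

/-- `0 < r(L)` for `L ≥ 0`. [folklore] -/
theorem logRate_pos {L : ℝ} (hL : 0 ≤ L) : 0 < Real.log (Real.exp 1 + L) / (1 + L) :=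
  lt_of_lt_of_le (by positivity) (one_div_le_logRate hL)

/-- `r(L) ≤ 1` for `L ≥ 0`. [folklore] -/
theorem logRate_le_one {L : ℝ} (hL : 0 ≤ L) : Real.log (Real.exp 1 + L) / (1 + L) ≤ 1 := by
  rw [div_le_one (by linarith)]
  exact log_exp_one_add_le hL

/-- **`r` IS ANTITONE on `[0, ∞)`**: `0 ≤ a ≤ b ⇒ r(b) ≤ r(a)` (`log(e+b) ≤ log(e+a) + (b−a)∕(e+a)`, `(1+a)∕(e+a) ≤ 1 ≤ log(e+a)`). [folklore] -/
theorem logRate_antitone {a b : ℝ} (ha : 0 ≤ a) (hab : a ≤ b) :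
    Real.log (Real.exp 1 + b) / (1 + b) ≤ Real.log (Real.exp 1 + a) / (1 + a) := by
  have he := Real.exp_pos 1
  have he1 : 1 ≤ Real.exp 1 := by linarith [Real.add_one_le_exp (1 : ℝ)]
  have hea : 0 < Real.exp 1 + a := by linarith
  have heb : 0 < Real.exp 1 + b := by linarith
  have h1a : 1 ≤ Real.log (Real.exp 1 + a) := by
    calc (1 : ℝ) = Real.log (Real.exp 1) := (Real.log_exp 1).symm
      _ ≤ Real.log (Real.exp 1 + a) := Real.log_le_log he (by linarith)
  have hlog : Real.log (Real.exp 1 + b) ≤ Real.log (Real.exp 1 + a) + (b - a) / (Real.exp 1 + a) := by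
    have hpos : 0 < (Real.exp 1 + b) / (Real.exp 1 + a) := div_pos heb hea
    have h := Real.log_le_sub_one_of_pos hpos
    rw [Real.log_div heb.ne' hea.ne'] at h
    have e : (Real.exp 1 + b) / (Real.exp 1 + a) - 1 = (b - a) / (Real.exp 1 + a) := by
      field_simp
      ring
    linarith
  have h2 : (b - a) / (Real.exp 1 + a) * (1 + a) ≤ b - a := by
    rw [div_mul_eq_mul_div, div_le_iff₀ hea]
    nlinarith
  rw [div_le_div_iff₀ (by linarith) (by linarith)]
  calc Real.log (Real.exp 1 + b) * (1 + a) ≤ (Real.log (Real.exp 1 + a) + (b - a) / (Real.exp 1 + a)) * (1 + a) :=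
        mul_le_mul_of_nonneg_right hlog (by linarith)
    _ = Real.log (Real.exp 1 + a) * (1 + a) + (b - a) / (Real.exp 1 + a) * (1 + a) := by ring
    _ ≤ Real.log (Real.exp 1 + a) * (1 + a) + (b - a) * Real.log (Real.exp 1 + a) := by nlinarith
    _ = Real.log (Real.exp 1 + a) * (1 + b) := by ring

/-- **SLOW VARIATION**: `r(L) ≤ (1+d)·r(L+d)` for `L, d ≥ 0` (`1 + L + d ≤ (1+L)(1+d)`). [folklore] -/
theorem logRate_le_mul_logRate_add {L d : ℝ} (hL : 0 ≤ L) (hd : 0 ≤ d) :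
    Real.log (Real.exp 1 + L) / (1 + L) ≤ (1 + d) * (Real.log (Real.exp 1 + (L + d)) / (1 + (L + d))) := by
  have h1 : Real.log (Real.exp 1 + L) ≤ Real.log (Real.exp 1 + (L + d)) :=
    Real.log_le_log (by positivity) (by linarith)
  have h0 : 0 ≤ Real.log (Real.exp 1 + L) := Real.log_nonneg (by linarith [Real.add_one_le_exp (1 : ℝ)])
  have hx : 0 ≤ Real.log (Real.exp 1 + (L + d)) := h0.trans h1
  have hq : 1 ≤ (1 + d) * (1 + L) / (1 + (L + d)) := by
    rw [le_div_iff₀ (by linarith)]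
    nlinarith
  rw [div_le_iff₀ (show (0 : ℝ) < 1 + L by linarith)]
  calc Real.log (Real.exp 1 + L) ≤ Real.log (Real.exp 1 + (L + d)) * 1 := by rw [mul_one]; exact h1
    _ ≤ Real.log (Real.exp 1 + (L + d)) * ((1 + d) * (1 + L) / (1 + (L + d))) := mul_le_mul_of_nonneg_left hq hx
    _ = (1 + d) * (Real.log (Real.exp 1 + (L + d)) / (1 + (L + d))) * (1 + L) := by
        field_simp

/-- **`ε ↦ r(log⁺ε⁻¹)` IS MONOTONE**: `0 < x ≤ y ⇒ r(log⁺x⁻¹) ≤ r(log⁺y⁻¹)`. [folklore] -/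
theorem logRate_posLog_inv_mono {x y : ℝ} (hx : 0 < x) (hxy : x ≤ y) :
    Real.log (Real.exp 1 + Real.posLog x⁻¹) / (1 + Real.posLog x⁻¹) ≤
      Real.log (Real.exp 1 + Real.posLog y⁻¹) / (1 + Real.posLog y⁻¹) :=
  logRate_antitone Real.posLog_nonneg (Real.posLog_le_posLog (inv_nonneg.2 (hx.le.trans hxy)) (inv_anti₀ hx hxy))

/-- **SCALING**: `0 < x`, `0 < y ≤ c·x`, `1 ≤ c` ⇒ `r(log⁺y⁻¹) ≤ (1 + log c)·r(log⁺x⁻¹)` (`log⁺x⁻¹ ≤ log c + log⁺(cx)⁻¹` and slow variation).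
[folklore] -/
theorem logRate_posLog_inv_le_of_le_mul {x y c : ℝ} (hx : 0 < x) (hy : 0 < y) (hc : 1 ≤ c) (hyc : y ≤ c * x) :
    Real.log (Real.exp 1 + Real.posLog y⁻¹) / (1 + Real.posLog y⁻¹) ≤
      (1 + Real.log c) * (Real.log (Real.exp 1 + Real.posLog x⁻¹) / (1 + Real.posLog x⁻¹)) := by
  have hc0 : 0 < c := by linarith
  set L : ℝ := Real.posLog x⁻¹ with hLdef
  set L' : ℝ := Real.posLog (c * x)⁻¹ with hL'def
  have hL'0 : 0 ≤ L' := Real.posLog_nonneg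
  -- `L' ≤ L ≤ L' + log c`
  have hL'L : L' ≤ L :=
    Real.posLog_le_posLog (inv_nonneg.2 (by positivity)) (inv_anti₀ hx (le_mul_of_one_le_left hx.le hc))
  have hLL' : L ≤ L' + Real.log c := by
    have e : x⁻¹ = c * (c * x)⁻¹ := by field_simp
    have h := Real.posLog_mul (x := c) (y := (c * x)⁻¹)
    have hcl : Real.posLog c = Real.log c := Real.posLog_eq_log (x := c) (by rw [abs_of_pos hc0]; exact hc)
    rw [← e, hcl] at h
    linarith
  -- monotonicity `y ≤ cx`, then slow variation with `d = L − L'`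
  have h1 := logRate_posLog_inv_mono hy hyc
  have h2 := logRate_le_mul_logRate_add hL'0 (sub_nonneg.2 hL'L)
  rw [add_sub_cancel] at h2
  have hlogc : 0 ≤ Real.log c := Real.log_nonneg hc
  have hr0 : 0 ≤ Real.log (Real.exp 1 + L) / (1 + L) := (logRate_pos Real.posLog_nonneg).le
  calc Real.log (Real.exp 1 + Real.posLog y⁻¹) / (1 + Real.posLog y⁻¹)
      ≤ Real.log (Real.exp 1 + L') / (1 + L') := h1
    _ ≤ (1 + (L - L')) * (Real.log (Real.exp 1 + L) / (1 + L)) := h2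
    _ ≤ (1 + Real.log c) * (Real.log (Real.exp 1 + L) / (1 + L)) :=
        mul_le_mul_of_nonneg_right (by linarith) hr0

/-- The doubling instance used below: `r(log⁺(2x)⁻¹) ≤ (1 + log 2)·r(log⁺x⁻¹)` for `x ≥ 0` (at `x = 0` both rates are `1`). [folklore] -/
theorem logRate_posLog_inv_two_mul_le {x : ℝ} (hx : 0 ≤ x) :
    Real.log (Real.exp 1 + Real.posLog (2 * x)⁻¹) / (1 + Real.posLog (2 * x)⁻¹) ≤
      (1 + Real.log 2) * (Real.log (Real.exp 1 + Real.posLog x⁻¹) / (1 + Real.posLog x⁻¹)) := by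
  rcases hx.eq_or_lt with rfl | hx'
  · simp only [mul_zero, inv_zero, Real.posLog_zero, add_zero, Real.log_exp, div_one, mul_one]
    linarith [Real.log_nonneg (by norm_num : (1 : ℝ) ≤ 2)]
  · exact logRate_posLog_inv_le_of_le_mul hx' (by positivity) (by norm_num) le_rfl

/-! ## §2 The per-step law price for EVERY real `ε`, and for tests Lipschitz ∕ bounded on `[−1,1]` only [folklore] -/

section Laws

variable {μ ν : Measure ℝ} [IsProbabilityMeasure μ] [IsProbabilityMeasure ν]

/-- ★ **THE PER-STEP LAW PRICE, EVERY REAL `ε`.**  Probability laws `μ, ν` on `[−1,1]` with cgfs `ε`-close on `|t| ≤ l₀` (`0 < l₀`), `g`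
`K`-Lipschitz with `|g| ≤ G` on `[−1,1]`: `|∫g dν − ∫g dμ| ≤ 384·c(l₀)·(K+G)·r(log⁺ε⁻¹)`, `c(l₀) = 6 + l₀ + log max(1, 4e∕l₀)` — p555512
`law_price_le_logRate` for `0 < ε ≤ 1`; for `ε = 0` or `ε > 1` the rate is `r(0) = 1` and the bound is the trivial `2G`; `ε < 0` is empty.
[folklore] -/
theorem law_increment_le_logRate (hμ : μ (Set.Icc (-1 : ℝ) 1)ᶜ = 0) (hν : ν (Set.Icc (-1 : ℝ) 1)ᶜ = 0) {ε l₀ : ℝ}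
    (hl₀ : 0 < l₀) (hclose : ∀ t : ℝ, |t| ≤ l₀ → |cgf id ν t - cgf id μ t| ≤ ε)
    {g : ℝ → ℝ} {K : NNReal} (hg : LipschitzWith K g) {G : ℝ} (hG : ∀ x ∈ Set.Icc (-1 : ℝ) 1, |g x| ≤ G) :
    |∫ x, g x ∂ν - ∫ x, g x ∂μ| ≤
      384 * (6 + l₀ + Real.log (max 1 (4 * Real.exp 1 / l₀))) * (K + G) *
        (Real.log (Real.exp 1 + Real.posLog ε⁻¹) / (1 + Real.posLog ε⁻¹)) := by
  by_cases hε : 0 < ε ∧ ε ≤ 1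
  · exact law_price_le_logRate hμ hν hl₀ hε.1 hε.2 hclose hg hG
  · have hG0 : 0 ≤ G := (abs_nonneg _).trans (hG 0 ⟨by norm_num, by norm_num⟩)
    have hK0 : (0 : ℝ) ≤ K := K.2
    have hc6 : 6 ≤ 6 + l₀ + Real.log (max 1 (4 * Real.exp 1 / l₀)) := by
      have := Real.log_nonneg (le_max_left 1 (4 * Real.exp 1 / l₀)); linarith
    have hεnn : 0 ≤ ε := (abs_nonneg _).trans (hclose 0 (by rw [abs_zero]; exact hl₀.le))
    have hpos : Real.posLog ε⁻¹ = 0 := by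
      rw [Real.posLog_eq_zero_iff]
      rcases le_or_gt ε 1 with h | h
      · have h0 : ε = 0 := by
          by_contra hne
          exact hε ⟨lt_of_le_of_ne hεnn (Ne.symm hne), h⟩
        rw [h0, inv_zero, abs_zero]
        exact zero_le_one
      · rw [abs_of_pos (inv_pos.2 (by linarith))]
        exact inv_le_one_of_one_le₀ h.le
    have htriv : |∫ x, g x ∂ν - ∫ x, g x ∂μ| ≤ 2 * G := by
      calc |∫ x, g x ∂ν - ∫ x, g x ∂μ| ≤ |∫ x, g x ∂ν| + |∫ x, g x ∂μ| := abs_sub _ _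
        _ ≤ G + G := add_le_add (abs_integral_le_of_Icc_symm hν hG) (abs_integral_le_of_Icc_symm hμ hG)
        _ = 2 * G := by ring
    rw [hpos, add_zero, Real.log_exp, add_zero, div_one, mul_one]
    calc |∫ x, g x ∂ν - ∫ x, g x ∂μ| ≤ 2 * G := htriv
      _ ≤ 384 * (6 + l₀ + Real.log (max 1 (4 * Real.exp 1 / l₀))) * (K + G) := by nlinarith

/-- ★ **THE SAME FOR TESTS LIPSCHITZ ∕ BOUNDED ON `[−1,1]` ONLY** (`K`-Lipschitz and `|g| ≤ G` on `[−1,1]`; the laws do not see `g` elsewhere: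
compose with the `1`-Lipschitz retraction `Set.projIcc (−1) 1`). [folklore] -/
theorem law_increment_le_logRate_of_lipschitzOn (hμ : μ (Set.Icc (-1 : ℝ) 1)ᶜ = 0) (hν : ν (Set.Icc (-1 : ℝ) 1)ᶜ = 0) {ε l₀ : ℝ}
    (hl₀ : 0 < l₀) (hclose : ∀ t : ℝ, |t| ≤ l₀ → |cgf id ν t - cgf id μ t| ≤ ε)
    {g : ℝ → ℝ} {K G : ℝ} (hK0 : 0 ≤ K)
    (hK : ∀ x y : ℝ, x ∈ Set.Icc (-1 : ℝ) 1 → y ∈ Set.Icc (-1 : ℝ) 1 → |g x - g y| ≤ K * |x - y|)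
    (hG : ∀ x : ℝ, x ∈ Set.Icc (-1 : ℝ) 1 → |g x| ≤ G) :
    |∫ x, g x ∂ν - ∫ x, g x ∂μ| ≤
      384 * (6 + l₀ + Real.log (max 1 (4 * Real.exp 1 / l₀))) * (K + G) *
        (Real.log (Real.exp 1 + Real.posLog ε⁻¹) / (1 + Real.posLog ε⁻¹)) := by
  have h11 : (-1 : ℝ) ≤ 1 := by norm_num
  -- the retraction onto `[−1,1]`
  set p : ℝ → ℝ := fun x => ((Set.projIcc (-1 : ℝ) 1 h11 x : Set.Icc (-1 : ℝ) 1) : ℝ) with hp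
  have hpmem : ∀ x, p x ∈ Set.Icc (-1 : ℝ) 1 := fun x => (Set.projIcc (-1 : ℝ) 1 h11 x).2
  have hpid : ∀ x ∈ Set.Icc (-1 : ℝ) 1, p x = x := fun x hx => by
    simp only [hp, Set.projIcc_of_mem h11 hx]
  have hpL : ∀ x y : ℝ, |p x - p y| ≤ |x - y| := fun x y => by
    have h := (LipschitzWith.projIcc h11).dist_le_mul x y
    rw [NNReal.coe_one, one_mul, Subtype.dist_eq, Real.dist_eq, Real.dist_eq] at h
    exact h
  have hlip : LipschitzWith K.toNNReal (g ∘ p) := by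
    refine LipschitzWith.of_dist_le_mul fun x y => ?_
    rw [Function.comp_apply, Function.comp_apply, Real.dist_eq, Real.dist_eq, Real.coe_toNNReal _ hK0]
    calc |g (p x) - g (p y)| ≤ K * |p x - p y| := hK _ _ (hpmem x) (hpmem y)
      _ ≤ K * |x - y| := mul_le_mul_of_nonneg_left (hpL x y) hK0
  have hGp : ∀ x ∈ Set.Icc (-1 : ℝ) 1, |(g ∘ p) x| ≤ G := fun x hx => by
    rw [Function.comp_apply, hpid x hx]; exact hG x hx
  have key := law_increment_le_logRate hμ hν hl₀ hclose hlip hGp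
  -- the integrals against laws on `[−1,1]` do not see the retraction
  have hint : ∀ κ : Measure ℝ, κ (Set.Icc (-1 : ℝ) 1)ᶜ = 0 → ∫ x, (g ∘ p) x ∂κ = ∫ x, g x ∂κ := fun κ hκ => by
    refine integral_congr_ae ?_
    have hae : ∀ᵐ x ∂κ, x ∈ Set.Icc (-1 : ℝ) 1 := by
      rw [ae_iff]
      simpa only [Set.mem_Icc, Set.compl_def] using hκ
    exact hae.mono fun x hx => by simp only [Function.comp_apply, hpid x hx]
  rw [hint ν hν, hint μ hμ, Real.coe_toNNReal _ hK0] at key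
  exact key

/-! ## §3 Laws under `MatchingModConstants`: `|c_K| ≤ vol·δ_K`, per-step `r(log⁺(2vol·δ_K)⁻¹)`, and summability [folklore] -/

/-- **THE CONSTANTS ARE SMALL.**  For probability laws `λ_K` every cgf vanishes at `t = 0`, so `MatchingModConstants vol l₀ δ (K t ↦ mgf λ_K t)`
(`0 ≤ l₀`) forces `|c_K| ≤ vol·δ_K` and consecutive cgfs are `2vol·δ_K`-close on `|t| ≤ l₀`. [folklore] -/
theorem cgf_increment_le_of_matchingModConstants {Λ : ℕ → Measure ℝ} [hP : ∀ K, IsProbabilityMeasure (Λ K)] {vol l₀ : ℝ}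
    (hl₀ : 0 ≤ l₀) {δ : ℕ → ℝ} (hM : MatchingModConstants vol l₀ δ (fun K t => mgf id (Λ K) t)) (K : ℕ) (t : ℝ)
    (ht : |t| ≤ l₀) : |cgf id (Λ (K + 1)) t - cgf id (Λ K) t| ≤ 2 * (vol * δ K) := by
  obtain ⟨c, hc⟩ := hM K
  have h0 := hc 0 (by rw [abs_zero]; exact hl₀)
  simp only [mgf_zero, Real.log_one, sub_zero, zero_sub, abs_neg] at h0
  have h1 := hc t ht
  rw [cgf, cgf]
  calc |Real.log (mgf id (Λ (K + 1)) t) - Real.log (mgf id (Λ K) t)|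
      ≤ |Real.log (mgf id (Λ (K + 1)) t) - Real.log (mgf id (Λ K) t) - c| + |c| := by
        have := abs_add_le (Real.log (mgf id (Λ (K + 1)) t) - Real.log (mgf id (Λ K) t) - c) c
        rwa [sub_add_cancel] at this
    _ ≤ vol * δ K + vol * δ K := add_le_add h1 h0
    _ = 2 * (vol * δ K) := by ring

/-- `MatchingModConstants` forces `0 ≤ vol·δ_K` (an absolute value is bounded by it). [bookkeeping] -/
theorem vol_mul_delta_nonneg_of_matchingModConstants {vol l₀ : ℝ} (hl₀ : 0 ≤ l₀) {δ : ℕ → ℝ} {Z : ℕ → ℝ → ℝ}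
    (hM : MatchingModConstants vol l₀ δ Z) (K : ℕ) : 0 ≤ vol * δ K := by
  obtain ⟨c, hc⟩ := hM K
  exact (abs_nonneg _).trans (hc 0 (by rw [abs_zero]; exact hl₀))

/-- ★★ **PER STEP UNDER `MatchingModConstants`.**  Probability laws `λ_K` on `[−1,1]` with `MatchingModConstants vol l₀ δ (K t ↦ mgf λ_K t)`
(`0 < l₀`): for every `K` and every `g` `K_g`-Lipschitz and `G_g`-bounded on `[−1,1]`,
`|∫g dλ_{K+1} − ∫g dλ_K| ≤ 384c(l₀)(K_g+G_g)·r(log⁺(2vol·δ_K)⁻¹)`. [folklore] -/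
theorem lawIncrement_le_logRate_of_matchingModConstants {Λ : ℕ → Measure ℝ} [hP : ∀ K, IsProbabilityMeasure (Λ K)]
    (hΛ : ∀ K, Λ K (Set.Icc (-1 : ℝ) 1)ᶜ = 0) {vol l₀ : ℝ} (hl₀ : 0 < l₀) {δ : ℕ → ℝ}
    (hM : MatchingModConstants vol l₀ δ (fun K t => mgf id (Λ K) t)) (K : ℕ) {g : ℝ → ℝ} {Kg G : ℝ} (hK0 : 0 ≤ Kg)
    (hK : ∀ x y : ℝ, x ∈ Set.Icc (-1 : ℝ) 1 → y ∈ Set.Icc (-1 : ℝ) 1 → |g x - g y| ≤ Kg * |x - y|)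
    (hG : ∀ x : ℝ, x ∈ Set.Icc (-1 : ℝ) 1 → |g x| ≤ G) :
    |∫ x, g x ∂Λ (K + 1) - ∫ x, g x ∂Λ K| ≤
      384 * (6 + l₀ + Real.log (max 1 (4 * Real.exp 1 / l₀))) * (Kg + G) *
        (Real.log (Real.exp 1 + Real.posLog (2 * (vol * δ K))⁻¹) / (1 + Real.posLog (2 * (vol * δ K))⁻¹)) :=
  law_increment_le_logRate_of_lipschitzOn (hΛ K) (hΛ (K + 1)) hl₀
    (fun t ht => cgf_increment_le_of_matchingModConstants hl₀.le hM K t ht) hK0 hK hG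

/-- ★★ **THE UPPER HALF OF THE THRESHOLD.**  Probability laws `λ_K` on `[−1,1]` with `MatchingModConstants vol l₀ δ (K t ↦ mgf λ_K t)` (`0 < l₀`):
IF `Σ_K r(log⁺(vol·δ_K)⁻¹) < ∞` THEN along every test sequence `g_K`, uniformly `K_g`-Lipschitz and `G_g`-bounded on `[−1,1]`, the increments
`|∫g_K dλ_{K+1} − ∫g_K dλ_K|` are summable (dominated by `384(1+log 2)c(l₀)(K_g+G_g)·r(log⁺(vol·δ_K)⁻¹)`). [folklore] -/
theorem summable_lawIncrements_of_matchingModConstants {Λ : ℕ → Measure ℝ} [hP : ∀ K, IsProbabilityMeasure (Λ K)]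
    (hΛ : ∀ K, Λ K (Set.Icc (-1 : ℝ) 1)ᶜ = 0) {vol l₀ : ℝ} (hl₀ : 0 < l₀) {δ : ℕ → ℝ}
    (hM : MatchingModConstants vol l₀ δ (fun K t => mgf id (Λ K) t))
    (hS : Summable fun K => Real.log (Real.exp 1 + Real.posLog (vol * δ K)⁻¹) / (1 + Real.posLog (vol * δ K)⁻¹))
    {g : ℕ → ℝ → ℝ} {Kg G : ℝ} (hK0 : 0 ≤ Kg)
    (hK : ∀ (K : ℕ) (x y : ℝ), x ∈ Set.Icc (-1 : ℝ) 1 → y ∈ Set.Icc (-1 : ℝ) 1 → |g K x - g K y| ≤ Kg * |x - y|)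
    (hG : ∀ (K : ℕ) (x : ℝ), x ∈ Set.Icc (-1 : ℝ) 1 → |g K x| ≤ G) :
    Summable fun K => |∫ x, g K x ∂Λ (K + 1) - ∫ x, g K x ∂Λ K| := by
  have hG0 : 0 ≤ G := (abs_nonneg _).trans (hG 0 0 ⟨by norm_num, by norm_num⟩)
  have hc0 : 0 ≤ 6 + l₀ + Real.log (max 1 (4 * Real.exp 1 / l₀)) := by
    have := Real.log_nonneg (le_max_left 1 (4 * Real.exp 1 / l₀)); linarith
  refine Summable.of_nonneg_of_le (fun K => abs_nonneg _) (fun K => ?_)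
    (hS.mul_left (384 * (6 + l₀ + Real.log (max 1 (4 * Real.exp 1 / l₀))) * (Kg + G) * (1 + Real.log 2)))
  have hx : 0 ≤ vol * δ K := vol_mul_delta_nonneg_of_matchingModConstants hl₀.le hM K
  calc |∫ x, g K x ∂Λ (K + 1) - ∫ x, g K x ∂Λ K|
      ≤ 384 * (6 + l₀ + Real.log (max 1 (4 * Real.exp 1 / l₀))) * (Kg + G) *
          (Real.log (Real.exp 1 + Real.posLog (2 * (vol * δ K))⁻¹) / (1 + Real.posLog (2 * (vol * δ K))⁻¹)) :=
        lawIncrement_le_logRate_of_matchingModConstants hΛ hl₀ hM K hK0 (hK K) (hG K)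
    _ ≤ 384 * (6 + l₀ + Real.log (max 1 (4 * Real.exp 1 / l₀))) * (Kg + G) *
          ((1 + Real.log 2) * (Real.log (Real.exp 1 + Real.posLog (vol * δ K)⁻¹) / (1 + Real.posLog (vol * δ K)⁻¹))) :=
        mul_le_mul_of_nonneg_left (logRate_posLog_inv_two_mul_le hx) (by positivity)
    _ = 384 * (6 + l₀ + Real.log (max 1 (4 * Real.exp 1 / l₀))) * (Kg + G) * (1 + Real.log 2) *
          (Real.log (Real.exp 1 + Real.posLog (vol * δ K)⁻¹) / (1 + Real.posLog (vol * δ K)⁻¹)) := by ring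

end Laws

/-! ## §4 At the torus scheme, under N19's DECL hypothesis [bookkeeping] -/

section Scheme

variable {G : Type*} [GaugeGroup G] [MeasurableSpace G] [RegularGaugeGroup G] [HaarData G] {O : Type*}
  (S : TorusScheme G O) (hβ : ∀ K, 0 ≤ S.β K) (hm : ∀ K o, Measurable (S.obs K o)) (h1 : ∀ K o U, |S.obs K o U| ≤ 1)
include hβ hm h1

/-- ★ **PER STEP AT THE SCHEME.**  Under `MatchingModConstants vol l₀ δ (schemeZ S os)` (the first conjunct of N19's DECL target
`Spine.NE7.Target vol l₀ δ (schemeZ S os)`; `0 < l₀`), for every continuous `g`, `K_g`-Lipschitz and `G_g`-bounded on `[−1,1]`, the laws of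
`∏os` under consecutive Gibbs measures satisfy `|∫g(∏os) dgibbs_{K+1} − ∫g(∏os) dgibbs_K| ≤ 384c(l₀)(K_g+G_g)·r(log⁺(2vol·δ_K)⁻¹)`
(node U6's generating function is the cgf of the law: module 64). [bookkeeping] -/
theorem lawIncrement_le_logRate_of_matchingModConstants_scheme {vol l₀ : ℝ} (hl₀ : 0 < l₀) {δ : ℕ → ℝ} (os : List O)
    (hM : MatchingModConstants vol l₀ δ (schemeZ S os)) (K : ℕ) {g : ℝ → ℝ} (hg : Continuous g) {Kg Gg : ℝ} (hK0 : 0 ≤ Kg)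
    (hK : ∀ x y : ℝ, x ∈ Set.Icc (-1 : ℝ) 1 → y ∈ Set.Icc (-1 : ℝ) 1 → |g x - g y| ≤ Kg * |x - y|)
    (hG : ∀ x : ℝ, x ∈ Set.Icc (-1 : ℝ) 1 → |g x| ≤ Gg) :
    |∫ U, g (prodObs S (K + 1) os U) ∂gibbsMeasure (S.P (K + 1)) (S.β (K + 1)) -
        ∫ U, g (prodObs S K os U) ∂gibbsMeasure (S.P K) (S.β K)| ≤
      384 * (6 + l₀ + Real.log (max 1 (4 * Real.exp 1 / l₀))) * (Kg + Gg) *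
        (Real.log (Real.exp 1 + Real.posLog (2 * (vol * δ K))⁻¹) / (1 + Real.posLog (2 * (vol * δ K))⁻¹)) := by
  haveI hP : ∀ K, IsProbabilityMeasure (gibbsMeasure (G := G) (S.P K) (S.β K)) := fun K =>
    T4GenFunBounds.isProbabilityMeasure_gibbsMeasure (G := G) (S.P K) (hβ K)
  have hmeas : ∀ K, AEMeasurable (prodObs S K os) (gibbsMeasure (S.P K) (S.β K)) := fun K =>
    (T4GenFunBounds.measurable_prodObs S hm K os).aemeasurable
  haveI : ∀ K, IsProbabilityMeasure ((gibbsMeasure (S.P K) (S.β K)).map (prodObs S K os)) := fun K =>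
    Measure.isProbabilityMeasure_map (hmeas K)
  rw [← integral_map (hmeas (K + 1)) hg.aestronglyMeasurable, ← integral_map (hmeas K) hg.aestronglyMeasurable]
  refine law_increment_le_logRate_of_lipschitzOn (law_prodObs_Icc_compl S hm h1 K os) (law_prodObs_Icc_compl S hm h1 (K + 1) os)
    hl₀ (fun t ht => ?_) hK0 hK hG
  -- the generating-function increment on the window is `≤ 2vol·δ_K`
  obtain ⟨c, hc⟩ := hM K
  have h0 := hc 0 (by rw [abs_zero]; exact hl₀.le)
  have h1' := hc t ht
  have e : cgf id ((gibbsMeasure (S.P (K + 1)) (S.β (K + 1))).map (prodObs S (K + 1) os)) t -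
      cgf id ((gibbsMeasure (S.P K) (S.β K)).map (prodObs S K os)) t =
      (Real.log (schemeZ S os (K + 1) t) - Real.log (schemeZ S os K t) - c) -
        (Real.log (schemeZ S os (K + 1) 0) - Real.log (schemeZ S os K 0) - c) := by
    rw [← genFun_schemeZ_eq_cgf_law S hβ hm h1, ← genFun_schemeZ_eq_cgf_law S hβ hm h1]
    simp only [genFun]
    ring
  rw [e]
  calc |Real.log (schemeZ S os (K + 1) t) - Real.log (schemeZ S os K t) - c -
        (Real.log (schemeZ S os (K + 1) 0) - Real.log (schemeZ S os K 0) - c)|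
      ≤ |Real.log (schemeZ S os (K + 1) t) - Real.log (schemeZ S os K t) - c| +
        |Real.log (schemeZ S os (K + 1) 0) - Real.log (schemeZ S os K 0) - c| := abs_sub _ _
    _ ≤ vol * δ K + vol * δ K := add_le_add h1' h0
    _ = 2 * (vol * δ K) := by ring

/-- ★ **THE UPPER HALF OF THE THRESHOLD AT THE SCHEME.**  Under N19's DECL target `Spine.NE7.Target vol l₀ δ (schemeZ S os)` (`0 < l₀`):
IF `Σ_K r(log⁺(vol·δ_K)⁻¹) < ∞` THEN for every sequence `g_K` of continuous tests, uniformly `K_g`-Lipschitz and `G_g`-bounded on `[−1,1]`, the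
increments of `K ↦ ∫g_K(∏os) dgibbs_K` are summable.  (`Target`'s own `Summable δ` is not what decides this; `Σ r(log⁺(vol·δ_K)⁻¹) < ∞` does.)
[bookkeeping] -/
theorem summable_lawIncrements_of_target {vol l₀ : ℝ} (hl₀ : 0 < l₀) {δ : ℕ → ℝ} (os : List O)
    (hT : NE7.Target vol l₀ δ (schemeZ S os))
    (hS : Summable fun K => Real.log (Real.exp 1 + Real.posLog (vol * δ K)⁻¹) / (1 + Real.posLog (vol * δ K)⁻¹))
    {g : ℕ → ℝ → ℝ} (hg : ∀ K, Continuous (g K)) {Kg Gg : ℝ} (hK0 : 0 ≤ Kg)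
    (hK : ∀ (K : ℕ) (x y : ℝ), x ∈ Set.Icc (-1 : ℝ) 1 → y ∈ Set.Icc (-1 : ℝ) 1 → |g K x - g K y| ≤ Kg * |x - y|)
    (hG : ∀ (K : ℕ) (x : ℝ), x ∈ Set.Icc (-1 : ℝ) 1 → |g K x| ≤ Gg) :
    Summable fun K => |∫ U, g K (prodObs S (K + 1) os U) ∂gibbsMeasure (S.P (K + 1)) (S.β (K + 1)) -
      ∫ U, g K (prodObs S K os U) ∂gibbsMeasure (S.P K) (S.β K)| := by
  have hG0 : 0 ≤ Gg := (abs_nonneg _).trans (hG 0 0 ⟨by norm_num, by norm_num⟩)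
  have hc0 : 0 ≤ 6 + l₀ + Real.log (max 1 (4 * Real.exp 1 / l₀)) := by
    have := Real.log_nonneg (le_max_left 1 (4 * Real.exp 1 / l₀)); linarith
  refine Summable.of_nonneg_of_le (fun K => abs_nonneg _) (fun K => ?_)
    (hS.mul_left (384 * (6 + l₀ + Real.log (max 1 (4 * Real.exp 1 / l₀))) * (Kg + Gg) * (1 + Real.log 2)))
  have hx : 0 ≤ vol * δ K := vol_mul_delta_nonneg_of_matchingModConstants hl₀.le hT.1 K
  calc |∫ U, g K (prodObs S (K + 1) os U) ∂gibbsMeasure (S.P (K + 1)) (S.β (K + 1)) -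
        ∫ U, g K (prodObs S K os U) ∂gibbsMeasure (S.P K) (S.β K)|
      ≤ 384 * (6 + l₀ + Real.log (max 1 (4 * Real.exp 1 / l₀))) * (Kg + Gg) *
          (Real.log (Real.exp 1 + Real.posLog (2 * (vol * δ K))⁻¹) / (1 + Real.posLog (2 * (vol * δ K))⁻¹)) :=
        lawIncrement_le_logRate_of_matchingModConstants_scheme S hβ hm h1 hl₀ os hT.1 K (hg K) hK0 (hK K) (hG K)
    _ ≤ 384 * (6 + l₀ + Real.log (max 1 (4 * Real.exp 1 / l₀))) * (Kg + Gg) *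
          ((1 + Real.log 2) * (Real.log (Real.exp 1 + Real.posLog (vol * δ K)⁻¹) / (1 + Real.posLog (vol * δ K)⁻¹))) :=
        mul_le_mul_of_nonneg_left (logRate_posLog_inv_two_mul_le hx) (by positivity)
    _ = 384 * (6 + l₀ + Real.log (max 1 (4 * Real.exp 1 / l₀))) * (Kg + Gg) * (1 + Real.log 2) *
          (Real.log (Real.exp 1 + Real.posLog (vol * δ K)⁻¹) / (1 + Real.posLog (vol * δ K)⁻¹)) := by ring

end Scheme

end Summit.QuantumFields.YangMills.Theorems.BalabanUVNodesN19LawSummabilityThreshold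

end
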